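/-
Copyright (c) 2026 the pub-hodgecm-mathlib formalisation cell (harness21).  Prover seat hodgecm-mathlib-F0P3a-p04 (g22): line LH4, «DYADIC PAYDOWN» board (LH4-plan (g3)),
brick «DUAL-of-strata» — dual pieces at ANY non-split place from the (S2) strata-open text, no lattice frame, no skew uniformiser; 2026-09-02.
-/
import Literature.NumberTheory.Rogawski1990.UnitaryThreeUnipotentStrataCM                 -- ★ p849223 §CM: `sub_one_pow_eq_zero_iff_conj_localNonsplitEquiv`, `sub_one_pow_eq_zero_iff_of_isConj`, `continuous_conj_localNonsplitEquiv_one`; brings ★ `isClosed_setOf_coe_sub_one_pow_eq_zero`, ★ `smul_placesOver_eq_of_subsingleton`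
import Literature.NumberTheory.Automorphic.OrbitalIntegralIndicatorSeparation          -- ★ p846366: the abstract RANK head `det_classOrbitalIntegral_indicator_ne_zero`
import Literature.NumberTheory.Automorphic.OrbitalIntegralDualPieces                 -- ★ `exists_dualPieces_of_det_ne_zero` (RANK ⇒ DUAL by matrix inversion)
import Literature.NumberTheory.Rogawski1990.ShalikaGermExpansionHoweReduction      -- ★ p848172: `exists_dualPieces_total_of_subtype`
import Literature.NumberTheory.Rogawski1990.LocalTransferFundamentalLemma          -- ★ `isLocSmooth_indicator`
import Literature.NumberTheory.Automorphic.CMPrincipalSeriesJacquetEvalOne         -- ★ `nonarchimedeanGroup_cmLocal` (`U(Φ_N)(L⁺_v)` is non-archimedean)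
import Literature.NumberTheory.Automorphic.LocalUnitaryIntegralLevel               -- ★ `isCompact_isOpen_cmLocalIntegralLevel`
import HarnessLib

/-!
# DUAL PIECES for the unipotent orbital integrals of `U(Φ₃)(L⁺_v)` at ANY non-split place, from the STRATA-OPEN property alone ([Rogawski1990] §8.1 p. 113 l. 1–6)

Topic `NumberTheory/Rogawski1990`; namespace `Literature.NumberTheory.Rogawski1990`.  THEOREMS ONLY (no definition, no instance, no notation, no named fact, no `sorry`).
Cell `pub/hodgecm-mathlib` (D-0151), crux H413 = `stmt-HodgeConjecture-24833`, line LH4 (closer row `stub_N6ns`); «DYADIC PAYDOWN» board of LH4-plan (g3) (leaf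
`Cruxes/H413/Lines/F0_P3c_DyadicPaydown.lean` ED. 1, organ (D-SH) «Shalika at `Φ₃`, dyadic places», road ‹DUAL›), brick «DUAL-of-strata» (F0P3a-p04 (g22)).

WHY.  The ★ odd ‹DUAL› (p849114) and its unramified all-characteristic twin (★ p850106) get the reference pieces with an invertible orbital-integral table from EXPLICIT level
pieces (`K(2)`, `K(1)∖K(2)`, `K∖K(1)`, `R`) in an integral antidiagonal frame — hyperspecial at unramified places (★ RANK p848130 ∕ ★ p850074), and through a RAMIFIED BLOCK with
a skew uniformiser `σ_w ϖ = −ϖ` at tamely ramified places (★ RANK-ram).  At a WILD (ramified dyadic) place neither frame exists in the tree (census LH4-p02 (g2)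
`DYADIC-CENSUS.v1.md` (b1)(b2): no skew uniformiser in general, no wild hermitian lattice classification).  THIS FILE REMOVES THE FRAME: the invertible table only needs,
for each class `u′ ∈ S`, a compact open piece through a representative that MISSES every class of lower rank — and such pieces exist as soon as every unipotent class is
open inside its stratum, i.e. from the (S2) «strata-open» statement alone (Bernstein–Zelevinsky: orbits are locally closed).  So ‹DUAL› at a place holds whenever (S2)
holds there: at odd places ★ `exists_isOpen_forall_sameStratum_mem_iff_isConj` (p849223), at unramified places of any residue characteristic the (S2u) twin (A-p12 (g26)),
and at WILD places the same norm step that ‹SPAN-wild› needs (★ p850139 `exists_isOpen_transvection_class_of_norm_lt` + the square-root lemma (W-a)) — no lattice theory.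

THE ARGUMENT (all ★ currency).  `G = U(Φ₃)(L⁺_v) = (cmDatum L 3 Φ₃).Local v`; strata by `st γ ∈ {0,1,2}` (`γ = 1` ∕ transvection `(γ−1)² = 0, γ ≠ 1` ∕ regular); `st` is a
class function (★ `sub_one_pow_eq_zero_iff_of_isConj`) and the union of the strata STRICTLY below that of `x` is closed (`∅`, `{(γ−1)^1 = 0}`, `{(γ−1)² = 0}`: preimages
of ★ `isClosed_setOf_coe_sub_one_pow_eq_zero` under the continuous one-place model ★ `continuous_conj_localNonsplitEquiv_one`, read back by ★
`sub_one_pow_eq_zero_iff_conj_localNonsplitEquiv`).  Rank the classes of `S` by `b c := st (out c) · (#S + 1) + e c` for any injection `e : S ↪ [0, #S]`.  For `u′ ∈ S`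
with representative `x′ := out u′` let `O := V_{x′} ∩ (lower x′)ᶜ` (`V_{x′}` the (S2) open set): open, `x′ ∈ O`; since `G` is non-archimedean (★ `nonarchimedeanGroup_cmLocal`)
and `K = U(Φ₃)(𝒪_v)` is compact open (★ `isCompact_isOpen_cmLocalIntegralLevel`), `P u′ := x′ · (H ∩ K)` for an open subgroup `H ⊆ x′⁻¹ O` is clopen, compact, contains
`x′`, and lies in `O`.  If `b u < b u′` and `y ∈ P u′ ∩ 𝒪(u)` then `st y = st (out u) ≤ st x′` (rank order) and `st x′ ≤ st y` (`y ∉ lower x′`), so `y` is in the stratum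
of `x′`, so `y ∈ V_{x′}` forces `IsConj x′ y`, i.e. `u′ = u` — contradiction.  This is exactly the `hsep` clause of ★ `det_classOrbitalIntegral_indicator_ne_zero`
(p846366), which then gives `det (Φ_{mU}(u, 1_{P u′})) ≠ 0`; ★ `exists_dualPieces_of_det_ne_zero` inverts, ★ `exists_dualPieces_total_of_subtype` re-dresses.

* §1 (generic topological group) `exists_isOpen_isCompact_isClosed_nhds_subset` (compact-open neighbourhoods in a non-archimedean group with one compact open set at `1`),
  **`exists_indicator_det_classOrbitalIntegral_ne_zero_of_strata`** (an abstract stratification `st ∕ lower ∕ V` ⇒ reference pieces with invertible table).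
* §2 **`UnitaryGroup.exists_unipotentDualPieces_antidiagOne_of_strataOpen`** = ★ p849114 `UnitaryGroup.exists_unipotentDualPieces_antidiagOne_odd` with the token
  `IsUnit (2 : 𝒪[w.1.adicCompletion L]) →` REPLACED, at the same position, by the conclusion text of ★ (S2) `exists_isOpen_forall_sameStratum_mem_iff_isConj` (after its
  own `IsUnit 2 →`) as a hypothesis; every other byte identical.

HONEST LABEL: count-neutral pay-down (no organ of the dyadic leaf is discharged by this file alone; it turns ‹DUAL-wild› into «(S2) at wild places»); HC_CM is proved only
modulo the 7 printed citations (2 remaining: hLiu418 = stmt-HodgeConjecture-24832, h413 = stmt-HodgeConjecture-24833) until rung 0 closes.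

## References
* [Rogawski1990] J. D. Rogawski, *Automorphic Representations of Unitary Groups in Three Variables*, Ann. of Math. Stud. 123 (1990): §8.1, proof of Prop. 8.1.1 p. 113 (l. 1–6:
  «let `f_j ∈ C(G)` be such that `Φ(u_k, f_j) = δ_jk`»); §3.9 Prop. 3.9.1 p. 32 (unipotent classes and their closure order).
* [BernsteinZelevinsky1976] I. N. Bernstein, A. V. Zelevinsky, *Representations of the group GL(n, F) where F is a non-archimedean local field*, Russian Math. Surveys 31
  (1976), §1.5 (l-spaces, locally closed orbits, stratifications), §6 (linear independence of orbital functionals on distinct orbits).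
* [HarishChandra1999AdmissibleDistributions] Harish-Chandra (DeBacker–Sally), *Admissible Invariant Distributions on Reductive p-adic Groups*, ULS 16 (1999), §3.1 p. 17.
* [PlatonovRapinchuk1994] V. Platonov, A. Rapinchuk, *Algebraic Groups and Number Theory* (1994), §3.3 (non-archimedean topology of `G(K_v)`), §5.1.
-/

set_option autoImplicit false

noncomputable section

open MeasureTheory Measure NumberField IsDedekindDomain Topology Filter Set
open Literature.MeasureTheory.Group Literature.NumberTheory.Automorphic Literature.NumberTheory.Automorphic.UnitaryGroup
open Literature.NumberTheory.GaloisRepresentations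
open scoped Matrix MatrixGroups ValuativeRel

namespace Literature.NumberTheory.Rogawski1990

/-! ## §1 Generic: compact-open neighbourhoods; reference pieces from an abstract stratification -/

section Generic

/-- **Compact open neighbourhoods in a non-archimedean group with ONE compact open set through `1`**: every open `O ∋ x` contains a clopen compact `P ∋ x`
(`P = x · (H ∩ K)` for an open subgroup `H ⊆ x⁻¹ O`). [cite: PlatonovRapinchuk1994, §3.3] -/
theorem exists_isOpen_isCompact_isClosed_nhds_subset {G : Type*} [Group G] [TopologicalSpace G] [NonarchimedeanGroup G] {K : Set G} (hKc : IsCompact K) (hKo : IsOpen K)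
    (hKcl : IsClosed K) (h1 : (1 : G) ∈ K) {O : Set G} (hO : IsOpen O) {x : G} (hx : x ∈ O) :
    ∃ P : Set G, IsOpen P ∧ IsCompact P ∧ IsClosed P ∧ x ∈ P ∧ P ⊆ O := by
  have hcont : Continuous fun y : G => x * y := continuous_const.mul continuous_id
  have hO1 : (fun y => x * y) ⁻¹' O ∈ 𝓝 (1 : G) := (hO.preimage hcont).mem_nhds (by rw [Set.mem_preimage, mul_one]; exact hx)
  obtain ⟨H, hH⟩ := NonarchimedeanGroup.is_nonarchimedean _ hO1
  refine ⟨(Homeomorph.mulLeft x) '' ((H : Set G) ∩ K), ?_, ?_, ?_, ?_, ?_⟩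
  · exact (Homeomorph.mulLeft x).isOpen_image.2 (H.isOpen.inter hKo)
  · exact (hKc.of_isClosed_subset (H.isClosed.inter hKcl) Set.inter_subset_right).image (Homeomorph.mulLeft x).continuous
  · exact (Homeomorph.mulLeft x).isClosed_image.2 (H.isClosed.inter hKcl)
  · exact ⟨1, ⟨one_mem H, h1⟩, by simp only [Homeomorph.coe_mulLeft, mul_one]⟩
  · rintro _ ⟨y, ⟨hyH, -⟩, rfl⟩
    simpa only [Homeomorph.coe_mulLeft, Set.mem_preimage] using hH hyH

variable {G : Type*} [Group G] [TopologicalSpace G] [IsTopologicalGroup G] [SigmaCompactSpace G]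
  [∀ γ : G, MeasurableSpace (G ⧸ Subgroup.centralizer ({γ} : Set G))] [∀ γ : G, BorelSpace (G ⧸ Subgroup.centralizer ({γ} : Set G))]

open scoped Classical in
/-- **REFERENCE PIECES FROM AN ABSTRACT STRATIFICATION** (Bernstein–Zelevinsky).  Data: a finite set `S` of classes with representatives in a class-stable set `R`
(«unipotents»), an orbital-measure family admissible on `S` with the Rao clause, compact-open neighbourhoods (`hnhds`), a class function `st : G → ℕ` («stratum»),
for each `x` a set `lower x ∌ x` with open complement such that `y ∈ R ∖ lower x ⇒ st x ≤ st y`, and for each `x ∈ R` an open `V x` cutting out the class of `x` inside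
its stratum (`st y = st x → (y ∈ V x ↔ IsConj x y)`).  Then there are `C_c^∞` reference pieces `g_u` (`u ∈ S`) — indicators of clopen compact pieces through the
representatives — with `det (Φ_{mU}(u, g_{u′}))_{u,u′ ∈ S} ≠ 0` (★ `det_classOrbitalIntegral_indicator_ne_zero` with the rank `st (out c)·(#S+1) + e c`).
[cite: BernsteinZelevinsky1976, §1.5, §6] [cite: Rogawski1990, §8.1 p. 113] -/
theorem exists_indicator_det_classOrbitalIntegral_ne_zero_of_strata
    (S : Finset (ConjClasses G)) (mU : OrbitalMeasureFamily G)
    (hmU : mU.IsAdmissibleOn (fun γ => (ConjClasses.mk γ) ∈ S))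
    (hRao : ∀ u ∈ S, ∀ f : G → ℂ, IsLocSmooth f →
      Integrable (descConj (Quotient.out u : G) (Subgroup.centralizer ({(Quotient.out u : G)} : Set G))
        (fun _ hg => Subgroup.mem_centralizer_singleton_iff.1 hg) f) (mU u))
    (hnhds : ∀ (O : Set G) (x : G), IsOpen O → x ∈ O → ∃ P : Set G, IsOpen P ∧ IsCompact P ∧ IsClosed P ∧ x ∈ P ∧ P ⊆ O)
    (R : Set G) (hR : ∀ u ∈ S, (Quotient.out u : G) ∈ R) (hRconj : ∀ a b : G, IsConj a b → a ∈ R → b ∈ R)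
    (st : G → ℕ) (hst : ∀ a b : G, IsConj a b → st a = st b)
    (lower : G → Set G) (hlo : ∀ x, IsOpen (lower x)ᶜ) (hxlo : ∀ x, x ∉ lower x)
    (hle : ∀ x ∈ R, ∀ y ∈ R, y ∉ lower x → st x ≤ st y)
    (V : G → Set G) (hVo : ∀ x ∈ R, IsOpen (V x)) (hV : ∀ x ∈ R, ∀ y ∈ R, st y = st x → (y ∈ V x ↔ IsConj x y)) :
    ∃ gref : ↥S → G → ℂ, (∀ i, IsLocSmooth (gref i)) ∧
      (Matrix.of fun u u' : ↥S => classOrbitalIntegral mU (gref u') u).det ≠ 0 := by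
  -- the pieces `P c ∋ out c`, clopen compact, inside `V (out c) ∩ (lower (out c))ᶜ`
  have hP : ∀ c ∈ S, ∃ P : Set G, IsOpen P ∧ IsCompact P ∧ IsClosed P ∧ (Quotient.out c : G) ∈ P ∧ P ⊆ V (Quotient.out c) ∩ (lower (Quotient.out c))ᶜ :=
    fun c hc => hnhds _ _ ((hVo _ (hR c hc)).inter (hlo _)) ⟨(hV _ (hR c hc) _ (hR c hc) rfl).2 (IsConj.refl _), hxlo _⟩
  choose! P hPo hPc hPcl hPx hPsub using hP
  -- an injection `e : S ↪ [0, #S]`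
  obtain ⟨e, heinj, helt⟩ : ∃ e : ConjClasses G → ℕ, Set.InjOn e ↑S ∧ ∀ c ∈ S, e c < S.card + 1 := by
    refine ⟨fun c => if h : c ∈ S then ((S.equivFin ⟨c, h⟩ : Fin S.card) : ℕ) else 0, ?_, fun c hc => ?_⟩
    · intro c hc c' hc' h
      rw [Finset.mem_coe] at hc hc'
      simp only [dif_pos hc, dif_pos hc'] at h
      exact congrArg Subtype.val (S.equivFin.injective (Fin.ext h))
    · simp only [dif_pos hc]
      exact Nat.lt_succ_of_lt (S.equivFin ⟨c, hc⟩).isLt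
  -- the rank `b c = st (out c) · (#S + 1) + e c`
  obtain ⟨b, hb⟩ : ∃ b : ConjClasses G → ℕ, ∀ c, b c = st (Quotient.out c) * (S.card + 1) + e c := ⟨_, fun _ => rfl⟩
  have hout : ∀ c : ConjClasses G, ConjClasses.mk (Quotient.out c) = c := fun c => by
    rw [← ConjClasses.quotient_mk_eq_mk, Quotient.out_eq]
  refine ⟨fun u => (P u).indicator fun _ => (1 : ℂ), fun i => isLocSmooth_indicator (hPo i i.2) (hPcl i i.2) (hPc i i.2),
    det_classOrbitalIntegral_indicator_ne_zero S mU hmU hRao P hPo hPc hPcl (fun u hu => ⟨_, hPx u hu, hout u⟩) b ?_ ?_⟩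
  · -- `b` is injective on `S`
    intro c hc c' hc' h
    have hmod : ∀ d ∈ S, b d % (S.card + 1) = e d := fun d hd => by
      rw [hb, Nat.mul_comm, Nat.mul_add_mod, Nat.mod_eq_of_lt (helt d hd)]
    have he : e c = e c' := by rw [← hmod c hc, ← hmod c' hc', h]
    exact heinj hc hc' he
  · -- separation: the class `u` misses `P u′` when `b u < b u′`
    intro u hu u' hu' hlt y hy hyu
    have hst_le : st (Quotient.out u) ≤ st (Quotient.out u') := by
      by_contra hgt
      have hgt : st (Quotient.out u') < st (Quotient.out u) := not_le.1 hgt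
      have h' : b u' < b u := by
        rw [hb, hb]
        calc st (Quotient.out u') * (S.card + 1) + e u' < st (Quotient.out u') * (S.card + 1) + (S.card + 1) := by
              have := helt u' hu'; omega
          _ = (st (Quotient.out u') + 1) * (S.card + 1) := by ring
          _ ≤ st (Quotient.out u) * (S.card + 1) := Nat.mul_le_mul_right _ hgt
          _ ≤ st (Quotient.out u) * (S.card + 1) + e u := Nat.le_add_right _ _
      omega
    have hcy : IsConj (Quotient.out u) y := by rw [← ConjClasses.mk_eq_mk_iff_isConj, hout, hyu]
    have hyR : y ∈ R := hRconj _ _ hcy (hR u hu)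
    have hsty : st y = st (Quotient.out u) := (hst _ _ hcy).symm
    have hy' : y ∈ V (Quotient.out u') ∩ (lower (Quotient.out u'))ᶜ := hPsub u' hu' hy
    have hge : st (Quotient.out u') ≤ st y := hle _ (hR u' hu') _ hyR hy'.2
    have heq : st y = st (Quotient.out u') := le_antisymm (hsty ▸ hst_le) hge
    have hconj : IsConj (Quotient.out u') y := (hV _ (hR u' hu') _ hyR heq).1 hy'.1
    have huu : u' = u := by rw [← hout u', ← hyu, ConjClasses.mk_eq_mk_iff_isConj]; exact hconj
    subst huu
    exact lt_irrefl _ hlt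

end Generic

/-! ## §2 The head: ‹DUAL› for `U(Φ₃)(L⁺_v)` at ANY non-split place, from (S2) -/

set_option maxHeartbeats 800000 in
-- statement-heavy: four instance binders and the (S2) text as a hypothesis (as ★ p849114 ∕ ★ p849223)
/-- **‹DUAL› FROM STRATA-OPEN, at ANY non-split place** (= ★ `UnitaryGroup.exists_unipotentDualPieces_antidiagOne_odd` with the hypothesis `2 ∈ 𝒪_w^×` replaced by the
conclusion text of ★ (S2) `exists_isOpen_forall_sameStratum_mem_iff_isConj`): if every unipotent class of `U(Φ₃)(L⁺_v)` is cut out by an open set inside its stratum, then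
for every finite set `S` of unipotent classes and every orbital-measure family `mU` admissible on `S` with the Ranga-Rao clause there are `fd u ∈ C_c^∞(G)` with
`Φ_{mU}(u, fd u) = 1` and `Φ_{mU}(u, fd u′) = 0` (`u ≠ u′`).  Proof: §1 with `R = {(γ−1)³ = 0}`, `st` the stratum index, `lower x` the union of the strata strictly below
`x` (closed by the (S1) mechanism, parity-free), `V` the (S2) sets; then ★ matrix inversion + ★ the total re-dress.
[cite: Rogawski1990, §8.1 p. 113; §3.9 Prop. 3.9.1 p. 32] [cite: BernsteinZelevinsky1976, §1.5, §6] [cite: HarishChandra1999AdmissibleDistributions, §3.1 p. 17] -/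
theorem UnitaryGroup.exists_unipotentDualPieces_antidiagOne_of_strataOpen :
    ∀ (L : Type) [Field L] [NumberField L] [IsCMField L] (v : HeightOneSpectrum (𝓞 ↥(maximalRealSubfield L))) (w : UnitaryGroup.PlacesOver L v),
      Subsingleton (UnitaryGroup.PlacesOver L v) → 
      (∀ u : (cmDatum L 3 (Matrix.of fun i j : Fin 3 => if i.val + j.val + 1 = 3 then (1 : L) else 0)).Local v, ((u.val : GL (Fin 3) (UnitaryGroup.LocalRing L v)).val - 1) ^ 3 = 0 →
        ∃ V : Set ((cmDatum L 3 (Matrix.of fun i j : Fin 3 => if i.val + j.val + 1 = 3 then (1 : L) else 0)).Local v), IsOpen V ∧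
          ∀ γ : (cmDatum L 3 (Matrix.of fun i j : Fin 3 => if i.val + j.val + 1 = 3 then (1 : L) else 0)).Local v, (((γ.val : GL (Fin 3) (UnitaryGroup.LocalRing L v)).val - 1) ^ 3 = 0 ∧ (((γ.val : GL (Fin 3) (UnitaryGroup.LocalRing L v)).val - 1) ^ 2 = 0 ↔ ((u.val : GL (Fin 3) (UnitaryGroup.LocalRing L v)).val - 1) ^ 2 = 0) ∧ (γ = 1 ↔ u = 1)) →
            (γ ∈ V ↔ IsConj u γ)) →
      ∀ [MeasurableSpace ((cmDatum L 3 (Matrix.of fun i j : Fin 3 => if i.val + j.val + 1 = 3 then (1 : L) else 0)).Local v)] [BorelSpace ((cmDatum L 3 (Matrix.of fun i j : Fin 3 => if i.val + j.val + 1 = 3 then (1 : L) else 0)).Local v)]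
        [∀ γ : ((cmDatum L 3 (Matrix.of fun i j : Fin 3 => if i.val + j.val + 1 = 3 then (1 : L) else 0)).Local v), MeasurableSpace (((cmDatum L 3 (Matrix.of fun i j : Fin 3 => if i.val + j.val + 1 = 3 then (1 : L) else 0)).Local v) ⧸ Subgroup.centralizer ({γ} : Set ((cmDatum L 3 (Matrix.of fun i j : Fin 3 => if i.val + j.val + 1 = 3 then (1 : L) else 0)).Local v)))]
        [∀ γ : ((cmDatum L 3 (Matrix.of fun i j : Fin 3 => if i.val + j.val + 1 = 3 then (1 : L) else 0)).Local v), BorelSpace (((cmDatum L 3 (Matrix.of fun i j : Fin 3 => if i.val + j.val + 1 = 3 then (1 : L) else 0)).Local v) ⧸ Subgroup.centralizer ({γ} : Set ((cmDatum L 3 (Matrix.of fun i j : Fin 3 => if i.val + j.val + 1 = 3 then (1 : L) else 0)).Local v)))],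
      ∀ (S : Finset (ConjClasses ((cmDatum L 3 (Matrix.of fun i j : Fin 3 => if i.val + j.val + 1 = 3 then (1 : L) else 0)).Local v))) (mU : OrbitalMeasureFamily ((cmDatum L 3 (Matrix.of fun i j : Fin 3 => if i.val + j.val + 1 = 3 then (1 : L) else 0)).Local v)),
        (∀ u ∈ S, (((Quotient.out u : ((cmDatum L 3 (Matrix.of fun i j : Fin 3 => if i.val + j.val + 1 = 3 then (1 : L) else 0)).Local v)).val : GL (Fin 3) (UnitaryGroup.LocalRing L v)).val - 1) ^ 3 = 0) →
        mU.IsAdmissibleOn (fun γ : ((cmDatum L 3 (Matrix.of fun i j : Fin 3 => if i.val + j.val + 1 = 3 then (1 : L) else 0)).Local v) => (ConjClasses.mk γ) ∈ S) →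
        (∀ u ∈ S, ∀ f : ((cmDatum L 3 (Matrix.of fun i j : Fin 3 => if i.val + j.val + 1 = 3 then (1 : L) else 0)).Local v) → ℂ, IsLocSmooth f →
            Integrable (descConj (Quotient.out u : ((cmDatum L 3 (Matrix.of fun i j : Fin 3 => if i.val + j.val + 1 = 3 then (1 : L) else 0)).Local v)) (Subgroup.centralizer ({(Quotient.out u : ((cmDatum L 3 (Matrix.of fun i j : Fin 3 => if i.val + j.val + 1 = 3 then (1 : L) else 0)).Local v))} : Set ((cmDatum L 3 (Matrix.of fun i j : Fin 3 => if i.val + j.val + 1 = 3 then (1 : L) else 0)).Local v)))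
              (fun _ hg => Subgroup.mem_centralizer_singleton_iff.1 hg) f) (mU u)) →
        ∃ fd : ConjClasses ((cmDatum L 3 (Matrix.of fun i j : Fin 3 => if i.val + j.val + 1 = 3 then (1 : L) else 0)).Local v) → ((cmDatum L 3 (Matrix.of fun i j : Fin 3 => if i.val + j.val + 1 = 3 then (1 : L) else 0)).Local v) → ℂ,
          (∀ u ∈ S, IsLocSmooth (fd u)) ∧ (∀ u ∈ S, classOrbitalIntegral mU (fd u) u = 1) ∧
          (∀ u ∈ S, ∀ u' ∈ S, u ≠ u' → classOrbitalIntegral mU (fd u') u = 0) := by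
  intro L _ _ _ v w hsub hS2 _ _ _ _ S mU hS hmU hRao
  classical
  have hw : IsCMField.complexConj L • w.1 = w.1 := smul_placesOver_eq_of_subsingleton L v (IsCMField.complexConj L) hsub w
  -- `G` is non-archimedean and `K = U(Φ₃)(𝒪_v)` is compact open: compact-open neighbourhoods everywhere
  haveI : NonarchimedeanGroup ((cmDatum L 3 (Matrix.of fun i j : Fin 3 => if i.val + j.val + 1 = 3 then (1 : L) else 0)).Local v) := nonarchimedeanGroup_cmLocal L 3 v
  obtain ⟨hKc, hKo⟩ := isCompact_isOpen_cmLocalIntegralLevel L 3 (Matrix.of fun i j : Fin 3 => if i.val + j.val + 1 = 3 then (1 : L) else 0) v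
  have hKcl : IsClosed (cmLocalIntegralLevel L 3 (Matrix.of fun i j : Fin 3 => if i.val + j.val + 1 = 3 then (1 : L) else 0) v : Set ((cmDatum L 3 (Matrix.of fun i j : Fin 3 => if i.val + j.val + 1 = 3 then (1 : L) else 0)).Local v)) :=
    (cmLocalIntegralLevel L 3 (Matrix.of fun i j : Fin 3 => if i.val + j.val + 1 = 3 then (1 : L) else 0) v).isClosed_of_isOpen hKo
  have hnhds : ∀ (O : Set ((cmDatum L 3 (Matrix.of fun i j : Fin 3 => if i.val + j.val + 1 = 3 then (1 : L) else 0)).Local v)) (x : ((cmDatum L 3 (Matrix.of fun i j : Fin 3 => if i.val + j.val + 1 = 3 then (1 : L) else 0)).Local v)), IsOpen O → x ∈ O → ∃ P : Set ((cmDatum L 3 (Matrix.of fun i j : Fin 3 => if i.val + j.val + 1 = 3 then (1 : L) else 0)).Local v), IsOpen P ∧ IsCompact P ∧ IsClosed P ∧ x ∈ P ∧ P ⊆ O :=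
    fun O x hO hx => exists_isOpen_isCompact_isClosed_nhds_subset hKc hKo hKcl (Subgroup.one_mem _) hO hx
  -- the unipotency predicates `N k γ :≡ (γ − 1)^k = 0`, their closedness (the (S1) mechanism, parity-free) and class invariance
  obtain ⟨N, hN⟩ : ∃ N : ℕ → ((cmDatum L 3 (Matrix.of fun i j : Fin 3 => if i.val + j.val + 1 = 3 then (1 : L) else 0)).Local v) → Prop, ∀ k γ, N k γ ↔ ((γ.val : GL (Fin 3) (UnitaryGroup.LocalRing L v)).val - 1) ^ k = 0 := ⟨_, fun _ _ => Iff.rfl⟩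
  have hNcl : ∀ k, IsClosed {γ : ((cmDatum L 3 (Matrix.of fun i j : Fin 3 => if i.val + j.val + 1 = 3 then (1 : L) else 0)).Local v) | N k γ} := by
    intro k
    have hset : {γ : ((cmDatum L 3 (Matrix.of fun i j : Fin 3 => if i.val + j.val + 1 = 3 then (1 : L) else 0)).Local v) | N k γ} =
        (fun y : ((cmDatum L 3 (Matrix.of fun i j : Fin 3 => if i.val + j.val + 1 = 3 then (1 : L) else 0)).Local v) => ((1 : GL (Fin 3) (w.1.adicCompletion L)) * ((localNonsplitEquiv (IsCMField.complexConj L) (Matrix.of fun i j : Fin 3 => if i.val + j.val + 1 = 3 then (1 : L) else 0) (IsCMField.complexConj_ne_one L) w hw y : ↥(unitaryGroupOfForm (galAdicCompletionMap (L := L) (IsCMField.complexConj L) hw) (placeForm (Matrix.of fun i j : Fin 3 => if i.val + j.val + 1 = 3 then (1 : L) else 0) w.1))) : GL (Fin 3) (w.1.adicCompletion L)) * (1 : GL (Fin 3) (w.1.adicCompletion L))⁻¹)) ⁻¹'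
          {g : GL (Fin 3) (w.1.adicCompletion L) | ((g : Matrix (Fin 3) (Fin 3) (w.1.adicCompletion L)) - 1) ^ k = 0} := by
      ext γ
      simp only [Set.mem_setOf_eq, Set.mem_preimage, hN]
      exact sub_one_pow_eq_zero_iff_conj_localNonsplitEquiv L w hw hsub γ k
    rw [hset]
    exact (isClosed_setOf_coe_sub_one_pow_eq_zero k).preimage (continuous_conj_localNonsplitEquiv_one L w hw)
  have hNconj : ∀ {a b : ((cmDatum L 3 (Matrix.of fun i j : Fin 3 => if i.val + j.val + 1 = 3 then (1 : L) else 0)).Local v)}, IsConj a b → ∀ k, (N k a ↔ N k b) := fun hab k => by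
    rw [hN, hN]; exact sub_one_pow_eq_zero_iff_of_isConj L w hw hsub hab k
  have hN1 : ∀ γ : ((cmDatum L 3 (Matrix.of fun i j : Fin 3 => if i.val + j.val + 1 = 3 then (1 : L) else 0)).Local v), N 1 γ ↔ γ = 1 := fun γ => by
    rw [hN, pow_one, sub_eq_zero, Units.val_eq_one, OneMemClass.coe_eq_one]; exact Iff.rfl
  have hN21 : N 2 (1 : ((cmDatum L 3 (Matrix.of fun i j : Fin 3 => if i.val + j.val + 1 = 3 then (1 : L) else 0)).Local v)) := by
    have h := (hN1 1).2 rfl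
    rw [hN, pow_one] at h
    rw [hN, pow_two, h, mul_zero]
  -- stratum index, lower unions, and their bookkeeping
  obtain ⟨st, hst⟩ : ∃ st : ((cmDatum L 3 (Matrix.of fun i j : Fin 3 => if i.val + j.val + 1 = 3 then (1 : L) else 0)).Local v) → ℕ, ∀ γ, st γ = if γ = 1 then 0 else if N 2 γ then 1 else 2 := ⟨_, fun _ => rfl⟩
  obtain ⟨lower, hlower⟩ : ∃ lower : ((cmDatum L 3 (Matrix.of fun i j : Fin 3 => if i.val + j.val + 1 = 3 then (1 : L) else 0)).Local v) → Set ((cmDatum L 3 (Matrix.of fun i j : Fin 3 => if i.val + j.val + 1 = 3 then (1 : L) else 0)).Local v), ∀ x, lower x = if x = 1 then ∅ else if N 2 x then {γ | N 1 γ} else {γ | N 2 γ} := ⟨_, fun _ => rfl⟩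
  have hst_iff : ∀ a b : ((cmDatum L 3 (Matrix.of fun i j : Fin 3 => if i.val + j.val + 1 = 3 then (1 : L) else 0)).Local v), st a = st b → ((N 2 a ↔ N 2 b) ∧ (a = 1 ↔ b = 1)) := by
    intro a b h
    rw [hst, hst] at h
    by_cases ha1 : a = 1 <;> by_cases hb1 : b = 1 <;> by_cases ha2 : N 2 a <;> by_cases hb2 : N 2 b <;>
      simp only [ha1, hb1, ha2, hb2, if_true, if_false] at h ⊢ <;> first | omega | (subst_vars; exact absurd hN21 ‹_›) | tauto
  have hstconj : ∀ a b : ((cmDatum L 3 (Matrix.of fun i j : Fin 3 => if i.val + j.val + 1 = 3 then (1 : L) else 0)).Local v), IsConj a b → st a = st b := by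
    intro a b hab
    rw [hst, hst]
    by_cases ha1 : a = 1
    · subst ha1
      rw [isConj_one_right.1 hab]
    · have hb1 : b ≠ 1 := fun hb => ha1 (isConj_one_left.1 (hb ▸ hab))
      rw [if_neg ha1, if_neg hb1]
      by_cases ha2 : N 2 a
      · rw [if_pos ha2, if_pos ((hNconj hab 2).1 ha2)]
      · rw [if_neg ha2, if_neg (fun h => ha2 ((hNconj hab 2).2 h))]
  have hlo : ∀ x : ((cmDatum L 3 (Matrix.of fun i j : Fin 3 => if i.val + j.val + 1 = 3 then (1 : L) else 0)).Local v), IsOpen (lower x)ᶜ := fun x => by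
    rw [hlower]; split_ifs
    · rw [Set.compl_empty]; exact isOpen_univ
    · exact (hNcl 1).isOpen_compl
    · exact (hNcl 2).isOpen_compl
  have hxlo : ∀ x : ((cmDatum L 3 (Matrix.of fun i j : Fin 3 => if i.val + j.val + 1 = 3 then (1 : L) else 0)).Local v), x ∉ lower x := fun x => by
    rw [hlower]; split_ifs with h1 h2
    · exact Set.notMem_empty _
    · rw [Set.mem_setOf_eq, hN1]; exact h1
    · exact h2
  have hle : ∀ x ∈ {γ : ((cmDatum L 3 (Matrix.of fun i j : Fin 3 => if i.val + j.val + 1 = 3 then (1 : L) else 0)).Local v) | N 3 γ}, ∀ y ∈ {γ : ((cmDatum L 3 (Matrix.of fun i j : Fin 3 => if i.val + j.val + 1 = 3 then (1 : L) else 0)).Local v) | N 3 γ}, y ∉ lower x → st x ≤ st y := by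
    intro x _ y _ hy
    rw [hlower] at hy
    rw [hst, hst]
    by_cases hx1 : x = 1
    · rw [if_pos hx1]; exact Nat.zero_le _
    rw [if_neg hx1] at hy ⊢
    by_cases hx2 : N 2 x
    · rw [if_pos hx2] at hy ⊢
      have hy1 : y ≠ 1 := fun h => hy (by rw [Set.mem_setOf_eq, hN1]; exact h)
      rw [if_neg hy1]; split_ifs <;> omega
    · rw [if_neg hx2] at hy ⊢
      have hy2 : ¬ N 2 y := hy
      have hy1 : y ≠ 1 := fun h => hy2 (h ▸ hN21)
      rw [if_neg hy1, if_neg hy2]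
  -- the (S2) sets
  have hS2' : ∀ u : ((cmDatum L 3 (Matrix.of fun i j : Fin 3 => if i.val + j.val + 1 = 3 then (1 : L) else 0)).Local v), N 3 u → ∃ V : Set ((cmDatum L 3 (Matrix.of fun i j : Fin 3 => if i.val + j.val + 1 = 3 then (1 : L) else 0)).Local v), IsOpen V ∧ ∀ γ : ((cmDatum L 3 (Matrix.of fun i j : Fin 3 => if i.val + j.val + 1 = 3 then (1 : L) else 0)).Local v), (N 3 γ ∧ (N 2 γ ↔ N 2 u) ∧ (γ = 1 ↔ u = 1)) → (γ ∈ V ↔ IsConj u γ) := by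
    intro u hu
    simp only [hN] at hu ⊢
    exact hS2 u hu
  choose! V hVo hV using hS2'
  have hV' : ∀ x ∈ {γ : ((cmDatum L 3 (Matrix.of fun i j : Fin 3 => if i.val + j.val + 1 = 3 then (1 : L) else 0)).Local v) | N 3 γ}, ∀ y ∈ {γ : ((cmDatum L 3 (Matrix.of fun i j : Fin 3 => if i.val + j.val + 1 = 3 then (1 : L) else 0)).Local v) | N 3 γ}, st y = st x → (y ∈ V x ↔ IsConj x y) :=
    fun x hx y hy h => hV x hx y ⟨hy, hst_iff y x h⟩
  -- §1
  obtain ⟨gref, hgs, hdet⟩ := exists_indicator_det_classOrbitalIntegral_ne_zero_of_strata S mU hmU hRao hnhds {γ : ((cmDatum L 3 (Matrix.of fun i j : Fin 3 => if i.val + j.val + 1 = 3 then (1 : L) else 0)).Local v) | N 3 γ}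
    (fun u hu => by rw [Set.mem_setOf_eq, hN]; exact hS u hu) (fun a b hab ha => (hNconj hab 3).1 ha) st hstconj lower hlo hxlo hle V
    (fun x hx => hVo x hx) hV'
  -- invert: Kronecker dual pieces on `↥S`, then the total dress
  obtain ⟨fdS, hfdS, hkron, -⟩ := exists_dualPieces_of_det_ne_zero S mU hRao gref hgs hdet
  exact exists_dualPieces_total_of_subtype S mU fdS hfdS (fun u => by simpa using hkron u u)
    (fun u u' hne => by simpa [if_neg hne] using hkron u u')

end Literature.NumberTheory.Rogawski1990

end
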